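import Mathlib
import Literature.Analysis.FluidPDE.SpaceTimeRescaling
import Literature.Analysis.FluidPDE.WeakSolutionProofs
import Summits.NavierStokesRegularity.NavierStokesRegularity.Theorems.EulerZoomLiouvillePowerGaugeEulerLiouvilleWrongParityMember
import HarnessLib

/-!
# Crux `EulerZoomLiouville.PowerGaugeEulerLiouville` (stmt-NavierStokesRegularity-19832), stub `stub_nonSelfSimilarRest`:
# NO MEMBER IS THE NEGATIVE OF ANOTHER EULER FLOW IN ITS FAR PAST — space/time ANTI-PERIODIC members are trivial

Helper file (theorems only; `--supports stmt-NavierStokesRegularity-19832`; def-free).  Hand leafhand-ns-eulerzoomliouville-10 g3; sequel of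
`…WrongParityMember` (anti-equivariance under a linear isometry).

PRINCIPLE.  The sign flip `u ↦ −u` reverses the linear part `∂ₜu + ∇p` of the Euler system against the even quadratic part `div(u ⊗ u)`.  Hence if a
class member `u` coincides on a past slab `τ < T₁` with `−u'` for ANY distributional Euler pair `(u', p')` on a past slab — an isometric conjugate,
a space translate `u(τ, x + d)`, a time translate `u(τ + P, x)`, a glide/screw combination, a rescaled copy — then `∂ₜu = 0` in `𝒟'` there
(`AntiMember.integral_deriv_mul_inner_eq_zero_of_negPair_past`), so `u` is a.e. steady (`DistSteady.exists_ae_eq_slice`) and trivial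
(`AePastSteady.ae_eq_zero_of_gauge_of_aePastSteady`):

* `Loc.ae_eq_zero_of_negPair` — MASTER THEOREM, member level, every `ρ > 0`, no regularity: crux hypotheses verbatim + a distributional Euler
  pair `(u', p')` on `(−∞,T₀) × ℝ³` with `u' = −u` for `τ < T₁ ≤ T₀ ≤ 0` ⇒ `u = 0` a.e.;
* `Birth.nonSelfSimilar_of_negPair` — the same in binder language (`Birth.InClass`);
* `Birth.nonSelfSimilar_of_spaceAntiPeriodic` — `u(τ, x + d) = −u(τ, x)` for `τ < T₁` (the partner is the space translate; compare the PERIODIC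
  stratum `u(τ, x + v) = u(τ, x)`, sense 2 of `IsWeakTamePast`, killed by a different mechanism);
* `Birth.nonSelfSimilar_of_timeAntiPeriodic` — `u(τ + P, x) = −u(τ, x)` for `τ < T₁`, `T₁ + P ≤ 0` (the partner is the time translate; compare the
  time-PERIODIC binder, sense 4 of `IsWeakTamePast` / `IsSymmetricWeak`).

WHAT THIS IS NOT: not a proof of the stub or of the crux; nothing about Navier–Stokes. [folklore; MajdaBertozziCUP2002 §1.2 Prop. 1.1]
-/

noncomputable section

-- flat `Theorems/<Route><Decl>…` files of one crux share the namespace of the crux (tree convention)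
set_option linter.dupNamespace false

open MeasureTheory Set Filter Topology Metric Function TopologicalSpace
open scoped RealInnerProductSpace NNReal ENNReal ContDiff

namespace Summit.NavierStokesRegularity.NavierStokesRegularity.Theorems.PowerGaugeEulerLiouville

open Literature.Analysis Literature.Analysis.FunctionSpaces Literature.Analysis.FluidPDE

/-! ## 1. The `±` pair with a partner on a past slab -/

/-- **A `±` PAIR WITH THE PARTNER ON A PAST SLAB.**  As `AntiMember.integral_deriv_mul_inner_eq_zero_of_negPair`, but the partner `(u', p')` need
only be a distributional Euler pair on a past slab `(−∞,T₀) × ℝ³`, `T₁ ≤ T₀ ≤ 0` (so that TIME-SHIFTED copies of the member qualify). [folklore] -/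
theorem AntiMember.integral_deriv_mul_inner_eq_zero_of_negPair_past {ρ : ℝ} (hρ : -1 < ρ)
    {u u' : ℝ → EuclideanSpace ℝ (Fin 3) → EuclideanSpace ℝ (Fin 3)} {p p' : ℝ → EuclideanSpace ℝ (Fin 3) → ℝ} {c : ℝ≥0}
    (hsw : IsSuitableWeakSolutionOn (slab (EuclideanSpace ℝ (Fin 3)) (Iio 0) isOpen_Iio) 0 0 u p)
    (hA : ∀ a : ℝ, 0 < a → ENNReal.ofReal (a ^ (2 * ρ)) * cknA a (0 : ℝ × EuclideanSpace ℝ (Fin 3)) u ≤ (c : ℝ≥0∞))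
    {T₀ T₁ : ℝ} (hT₀ : T₀ ≤ 0) (hT : T₁ ≤ T₀)
    (hdist' : IsDistributionalNSSolutionOn (slab (EuclideanSpace ℝ (Fin 3)) (Iio T₀) isOpen_Iio) 0 0 u' p')
    (hneg : ∀ t : ℝ, t < T₁ → ∀ x, u' t x = -u t x)
    {θ : ℝ → ℝ} (hθ : ContDiff ℝ ∞ θ) (hθc : HasCompactSupport θ) (hθT : tsupport θ ⊆ Iio T₁)
    {Φ : EuclideanSpace ℝ (Fin 3) → EuclideanSpace ℝ (Fin 3)} (hΦ : Continuous Φ) (hΦc : HasCompactSupport Φ) :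
    ∫ z : ℝ × EuclideanSpace ℝ (Fin 3), deriv θ z.1 * ⟪u z.1 z.2, Φ z.2⟫ = 0 := by
  have hT₁ : T₁ ≤ 0 := hT.trans hT₀
  have hdist := hsw.distributional
  have hdistT : IsDistributionalNSSolutionOn (slab (EuclideanSpace ℝ (Fin 3)) (Iio T₀) isOpen_Iio) 0 0 u p :=
    hdist.of_le (slab_mono (Iio_subset_Iio hT₀))
  have hθT0 : tsupport θ ⊆ Iio 0 := hθT.trans (Iio_subset_Iio hT₁)
  obtain ⟨hκ, hκc, hκT⟩ := AntiMember.deriv_cutoff_props hθ hθc hθT0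
  have hκT₁ : tsupport (deriv θ) ⊆ Iio T₁ := tsupport_deriv_subset.trans hθT
  have hu : LocallyIntegrableOn (uncurry u) (Iio 0 ×ˢ (univ : Set (EuclideanSpace ℝ (Fin 3)))) volume := by
    simpa only [coe_slab] using hdist.1
  -- (i) incompressibility, time-tested
  have hdiv : ∀ g : EuclideanSpace ℝ (Fin 3) → ℝ, IsTestFunctionOn (⊤ : Opens (EuclideanSpace ℝ (Fin 3))) g →
      ∫ z : ℝ × EuclideanSpace ℝ (Fin 3), deriv θ z.1 * ⟪u z.1 z.2, gradient g z.2⟫ = 0 := by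
    intro g hg
    have hg' : IsTestFunctionOn (⟨univ, isOpen_univ⟩ : Opens (EuclideanSpace ℝ (Fin 3))) g :=
      ⟨hg.contDiff, hg.hasCompactSupport, fun _ _ => trivial⟩
    have hΘ : IsSpaceTimeTestOn (slab (EuclideanSpace ℝ (Fin 3)) (Iio 0) isOpen_Iio) (fun t x => deriv θ t • g x) :=
      isSpaceTimeTestOn_prod_smul isOpen_Iio isOpen_univ (hθ.deriv') hκc hκT hg'
    have H := hdist.2.2.2.1 _ hΘ
    have hgd : Differentiable ℝ g := hg.contDiff.differentiable (by simp)
    have hpt : ∀ z : ℝ × EuclideanSpace ℝ (Fin 3),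
        ⟪u z.1 z.2, gradient (fun x => deriv θ z.1 • g x) z.2⟫ = deriv θ z.1 * ⟪u z.1 z.2, gradient g z.2⟫ := by
      intro z
      have e : (fun x => deriv θ z.1 • g x) = fun x => deriv θ z.1 * g x := rfl
      rw [e, ClockRigidity.gradient_const_mul' (hgd z.2), real_inner_smul_right]
    have hvan : ∀ z : ℝ × EuclideanSpace ℝ (Fin 3), z ∉ Iio (0 : ℝ) ×ˢ (univ : Set (EuclideanSpace ℝ (Fin 3))) →
        deriv θ z.1 * ⟪u z.1 z.2, gradient g z.2⟫ = 0 := by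
      intro z hz
      have ht : (0 : ℝ) ≤ z.1 := by
        by_contra h
        exact hz ⟨not_le.1 h, mem_univ _⟩
      rw [AntiMember.deriv_eq_zero_of_tsupport_subset_Iio hθT0 ht, zero_mul]
    have H' : ∫ z in Iio (0 : ℝ) ×ˢ (univ : Set (EuclideanSpace ℝ (Fin 3))), deriv θ z.1 * ⟪u z.1 z.2, gradient g z.2⟫ = 0 := by
      refine Eq.trans ?_ H
      rw [coe_slab]
      exact setIntegral_congr_fun (measurableSet_Iio.prod MeasurableSet.univ) (fun z _ => (hpt z).symm)
    rwa [setIntegral_eq_integral_of_forall_compl_eq_zero hvan] at H'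
  -- (ii) weak curl-freeness of the time-tested field, from the `±` pair
  have hcurl : ∀ g : EuclideanSpace ℝ (Fin 3) → ℝ, IsTestFunctionOn (⊤ : Opens (EuclideanSpace ℝ (Fin 3))) g →
      ∀ a c : EuclideanSpace ℝ (Fin 3),
        ∫ z : ℝ × EuclideanSpace ℝ (Fin 3), deriv θ z.1 * ⟪u z.1 z.2, fderiv ℝ g z.2 a • c - fderiv ℝ g z.2 c • a⟫ = 0 := by
    intro g hg a c'
    exact AntiMember.integral_deriv_mul_inner_divFree_eq_zero hT hdistT hdist' hneg hθ hθc hθT (isTestFunctionOn_curlPair hg a c')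
      (isDivFree_curlPair_of_contDiff (hg.contDiff.of_le (by norm_cast)) a c')
  -- (iii) growth from the `A`-gauge
  obtain ⟨M, hM⟩ := hκ.bounded_above_of_compact_support hκc
  obtain ⟨a₀, ha₀⟩ := hκc.isCompact.bddBelow
  set a : ℝ := min (a₀ - 1) (T₁ - 1) with hadef
  have hab : a < T₁ := lt_of_le_of_lt (min_le_right _ _) (by linarith)
  have hκS : ∀ t ∉ Ioo a T₁, deriv θ t = 0 := by
    intro t ht
    by_contra hne
    have hts : t ∈ tsupport (deriv θ) := subset_tsupport _ hne
    exact ht ⟨lt_of_le_of_lt (min_le_left _ _) (by linarith [ha₀ hts]), hκT₁ hts⟩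
  have hum : AEStronglyMeasurable (uncurry u) (volume.restrict (Iio (0 : ℝ) ×ˢ (univ : Set (EuclideanSpace ℝ (Fin 3))))) :=
    hu.aestronglyMeasurable
  set r₀ : ℝ := |a| + 1 with hr₀def
  have hgrowth : ∀ r : ℝ, r₀ < r → 0 < r →
      ∫⁻ x in ball (0 : EuclideanSpace ℝ (Fin 3)) r, ‖∫ t, deriv θ t • u t x‖ₑ ^ 2 ≤
        ENNReal.ofReal (M ^ 2 * (T₁ - a) * ((T₁ - a) * c) * r ^ (1 - 2 * ρ)) := by
    intro r hr hr0
    have hr1 : 1 < r := by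
      have : (0 : ℝ) ≤ |a| := abs_nonneg a
      linarith
    have hra : -(r ^ 2) < a := by
      have h1 : |a| < r := by linarith [abs_nonneg a]
      have h2 : r < r ^ 2 := by nlinarith
      have h3 : -|a| ≤ a := neg_abs_le a
      linarith
    have hB : ∀ t ∈ Ioo a T₁, ∫⁻ x in ball (0 : EuclideanSpace ℝ (Fin 3)) r, ‖u t x‖ₑ ^ 2 ≤
        ENNReal.ofReal ((c : ℝ) * r ^ (1 - 2 * ρ)) := fun t ht =>
      Backward.lintegral_ball_le_of_gaugeA hr0 (hA r hr0) ⟨by linarith [ht.1], lt_of_lt_of_le ht.2 hT₁⟩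
    have h1 := AntiMember.lintegral_ball_timeTested_le hum hT₁ hκS hM hB
    refine h1.trans (le_of_eq ?_)
    have hM0 : 0 ≤ M := (norm_nonneg _).trans (hM 0)
    have hTa : 0 ≤ T₁ - a := by linarith
    rw [← ENNReal.ofReal_mul (sq_nonneg M), ← ENNReal.ofReal_mul hTa, ← ENNReal.ofReal_mul (mul_nonneg (sq_nonneg M) hTa)]
    congr 1
    ring
  have hm : 1 - 2 * ρ < 3 := by linarith
  have hw0 := AntiMember.timeTested_ae_eq_zero hu hκ hκc hκT hdiv hcurl hm hgrowth
  rw [← AntiMember.integral_inner_timeTested hu hκ hκc hκT hΦ hΦc]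
  have : (fun x => ⟪(∫ t, deriv θ t • u t x), Φ x⟫) =ᵐ[volume] fun _ => (0 : ℝ) := by
    filter_upwards [hw0] with x hx
    rw [hx]; simp
  rw [integral_congr_ae this, integral_zero]


/-! ## 2. The master theorem and its binder-language instances -/

/-- **NO MEMBER IS THE NEGATIVE OF ANOTHER EULER FLOW IN ITS FAR PAST (master theorem; member level, every `ρ > 0`, no regularity).**  Let
`(u, p, H, c)` satisfy the crux hypotheses and let `(u', p')` be a distributional Euler pair on `(−∞,T₀) × ℝ³` with `u'(τ, x) = −u(τ, x)` for all
`τ < T₁`, all `x`, where `T₁ ≤ T₀ ≤ 0`.  Then `u = 0` a.e. on the slab. [folklore; MajdaBertozziCUP2002 §1.2 Prop. 1.1] -/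
theorem Loc.ae_eq_zero_of_negPair {ρ : ℝ} (hρ : 0 < ρ)
    {u u' : ℝ → EuclideanSpace ℝ (Fin 3) → EuclideanSpace ℝ (Fin 3)} {p p' : ℝ → EuclideanSpace ℝ (Fin 3) → ℝ}
    {H : ℝ → EuclideanSpace ℝ (Fin 3) → EuclideanSpace ℝ (Fin 3) →L[ℝ] EuclideanSpace ℝ (Fin 3)} {c : ℝ≥0}
    (hsw : IsSuitableWeakSolutionOn (slab (EuclideanSpace ℝ (Fin 3)) (Iio 0) isOpen_Iio) 0 0 u p)
    (hH : HasWeakSpatialGradientOn (slab (EuclideanSpace ℝ (Fin 3)) (Iio 0) isOpen_Iio) u H)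
    (hgauge : ∀ a : ℝ, 0 < a →
      ENNReal.ofReal (a ^ (2 * ρ)) * cknA a (0 : ℝ × EuclideanSpace ℝ (Fin 3)) u +
          ENNReal.ofReal (a ^ ρ) * cknE a (0 : ℝ × EuclideanSpace ℝ (Fin 3)) H +
        ENNReal.ofReal (a ^ (2 * ρ)) * cknD a (0 : ℝ × EuclideanSpace ℝ (Fin 3)) p ≤ (c : ℝ≥0∞))
    {T₀ T₁ : ℝ} (hT₀ : T₀ ≤ 0) (hT : T₁ ≤ T₀)
    (hdist' : IsDistributionalNSSolutionOn (slab (EuclideanSpace ℝ (Fin 3)) (Iio T₀) isOpen_Iio) 0 0 u' p')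
    (hneg : ∀ τ : ℝ, τ < T₁ → ∀ x : EuclideanSpace ℝ (Fin 3), u' τ x = -u τ x) :
    uncurry u =ᵐ[volume.restrict (Iio (0 : ℝ) ×ˢ (univ : Set (EuclideanSpace ℝ (Fin 3))))] 0 := by
  have hT₁ : T₁ ≤ 0 := hT.trans hT₀
  have hA : ∀ a : ℝ, 0 < a → ENNReal.ofReal (a ^ (2 * ρ)) *
      cknA a (0 : ℝ × EuclideanSpace ℝ (Fin 3)) u ≤ (c : ℝ≥0∞) :=
    fun a ha => le_trans (le_trans le_self_add le_self_add) (hgauge a ha)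
  have hsteady : ∀ θ : ℝ → ℝ, ContDiff ℝ ∞ θ → HasCompactSupport θ → tsupport θ ⊆ Iio T₁ →
      ∀ Φ : EuclideanSpace ℝ (Fin 3) → EuclideanSpace ℝ (Fin 3), Continuous Φ → HasCompactSupport Φ →
        ∫ z : ℝ × EuclideanSpace ℝ (Fin 3), deriv θ z.1 * ⟪u z.1 z.2, Φ z.2⟫ = 0 :=
    fun θ hθ hθc hθT Φ hΦ hΦc =>
      AntiMember.integral_deriv_mul_inner_eq_zero_of_negPair_past (by linarith) hsw hA hT₀ hT hdist' hneg hθ hθc hθT hΦ hΦc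
  have hu : LocallyIntegrableOn (uncurry u) (Iio T₁ ×ˢ (univ : Set (EuclideanSpace ℝ (Fin 3)))) volume := by
    have h0 : LocallyIntegrableOn (uncurry u) (Iio (0 : ℝ) ×ˢ (univ : Set (EuclideanSpace ℝ (Fin 3)))) volume := by
      simpa only [coe_slab] using hsw.distributional.1
    exact h0.mono_set (prod_mono (Iio_subset_Iio hT₁) Subset.rfl)
  have hsl : ∀ᵐ t ∂(volume.restrict (Iio T₁)), LocallyIntegrable (u t) volume := by
    filter_upwards [FrameSteady.ae_hasWeakFDerivOn_slice_past hH hT₁] with t ht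
    exact locallyIntegrableOn_univ.1 (by simpa only [Opens.coe_top] using ht.locallyIntegrableOn)
  obtain ⟨t₀, -, -, hU⟩ := DistSteady.exists_ae_eq_slice hu hsl hsteady
  exact AePastSteady.ae_eq_zero_of_gauge_of_aePastSteady hρ hsw hH hgauge hT₁ hU

/-- **Binder language: no member is the negative of another Euler flow in its far past.** [folklore] -/
theorem Birth.nonSelfSimilar_of_negPair :
    ∀ ρ : ℝ, 0 < ρ →
      ∀ (u : ℝ → EuclideanSpace ℝ (Fin 3) → EuclideanSpace ℝ (Fin 3)) (p : ℝ → EuclideanSpace ℝ (Fin 3) → ℝ)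
        (H : ℝ → EuclideanSpace ℝ (Fin 3) → EuclideanSpace ℝ (Fin 3) →L[ℝ] EuclideanSpace ℝ (Fin 3)) (c : ℝ≥0),
        Birth.InClass ρ u p H c →
          (∃ (T₀ T₁ : ℝ) (u' : ℝ → EuclideanSpace ℝ (Fin 3) → EuclideanSpace ℝ (Fin 3)) (p' : ℝ → EuclideanSpace ℝ (Fin 3) → ℝ),
              T₀ ≤ 0 ∧ T₁ ≤ T₀ ∧
              IsDistributionalNSSolutionOn (slab (EuclideanSpace ℝ (Fin 3)) (Iio T₀) isOpen_Iio) 0 0 u' p' ∧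
              ∀ τ : ℝ, τ < T₁ → ∀ x : EuclideanSpace ℝ (Fin 3), u' τ x = -u τ x) →
          uncurry u =ᵐ[volume.restrict (Iio (0 : ℝ) ×ˢ (univ : Set (EuclideanSpace ℝ (Fin 3))))] 0 := by
  intro ρ hρ u p H c hcl h
  obtain ⟨T₀, T₁, u', p', hT₀, hT, hdist', hneg⟩ := h
  exact Loc.ae_eq_zero_of_negPair hρ hcl.1 hcl.2.1 hcl.2.2 hT₀ hT hdist' hneg

/-- **SPACE-ANTI-PERIODIC MEMBERS ARE TRIVIAL**: `u(τ, x + d) = −u(τ, x)` for all `τ < T₁ ≤ 0`, all `x`, some `d ∈ ℝ³`, forces `u = 0` a.e. (the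
partner is the space translate `u(τ, d + ·)`, a distributional Euler pair on the whole slab). [folklore] -/
theorem Birth.nonSelfSimilar_of_spaceAntiPeriodic :
    ∀ ρ : ℝ, 0 < ρ →
      ∀ (u : ℝ → EuclideanSpace ℝ (Fin 3) → EuclideanSpace ℝ (Fin 3)) (p : ℝ → EuclideanSpace ℝ (Fin 3) → ℝ)
        (H : ℝ → EuclideanSpace ℝ (Fin 3) → EuclideanSpace ℝ (Fin 3) →L[ℝ] EuclideanSpace ℝ (Fin 3)) (c : ℝ≥0),
        Birth.InClass ρ u p H c →
          (∃ T₁ : ℝ, T₁ ≤ 0 ∧ ∃ d : EuclideanSpace ℝ (Fin 3),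
              ∀ τ : ℝ, τ < T₁ → ∀ x : EuclideanSpace ℝ (Fin 3), u τ (x + d) = -u τ x) →
          uncurry u =ᵐ[volume.restrict (Iio (0 : ℝ) ×ˢ (univ : Set (EuclideanSpace ℝ (Fin 3))))] 0 := by
  intro ρ hρ u p H c hcl h
  obtain ⟨T₁, hT₁, d, hanti⟩ := h
  -- the partner: the space translate, a distributional Euler pair on `(−∞,0) × ℝ³`
  have h1 := hcl.1.distributional.stRescale (α := 1) (γ := 1) (β := 1) one_pos one_pos (by norm_num) 0 d
  have hQ : stPreimage 1 1 0 d (slab (EuclideanSpace ℝ (Fin 3)) (Iio 0) isOpen_Iio) =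
      slab (EuclideanSpace ℝ (Fin 3)) (Iio 0) isOpen_Iio := by
    apply TopologicalSpace.Opens.ext
    ext z
    simp only [coe_stPreimage, coe_slab, mem_preimage, mem_prod, mem_univ, and_true, mem_Iio, stAffine_fst, one_mul, zero_add]
  rw [hQ, mul_zero, zero_div] at h1
  have h0 : ((1 : ℝ) ^ 2 * 1) • stPull 1 1 0 d (0 : ℝ → EuclideanSpace ℝ (Fin 3) → EuclideanSpace ℝ (Fin 3)) = 0 := by
    funext s y
    simp
  rw [h0, one_pow, one_smul, one_smul] at h1
  refine Loc.ae_eq_zero_of_negPair hρ hcl.1 hcl.2.1 hcl.2.2 le_rfl hT₁ h1 fun τ hτ x => ?_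
  rw [stPull_apply, one_mul, one_smul, zero_add, add_comm d x]
  exact hanti τ hτ x

/-- **TIME-ANTI-PERIODIC MEMBERS ARE TRIVIAL**: `u(τ + P, x) = −u(τ, x)` for all `τ < T₁`, all `x`, with `T₁ ≤ 0` and `T₁ + P ≤ 0`, forces
`u = 0` a.e. (the partner is the time translate `u(P + ·, ·)`, a distributional Euler pair on `(−∞, −P) × ℝ³`). [folklore] -/
theorem Birth.nonSelfSimilar_of_timeAntiPeriodic :
    ∀ ρ : ℝ, 0 < ρ →
      ∀ (u : ℝ → EuclideanSpace ℝ (Fin 3) → EuclideanSpace ℝ (Fin 3)) (p : ℝ → EuclideanSpace ℝ (Fin 3) → ℝ)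
        (H : ℝ → EuclideanSpace ℝ (Fin 3) → EuclideanSpace ℝ (Fin 3) →L[ℝ] EuclideanSpace ℝ (Fin 3)) (c : ℝ≥0),
        Birth.InClass ρ u p H c →
          (∃ T₁ P : ℝ, T₁ ≤ 0 ∧ T₁ + P ≤ 0 ∧
              ∀ τ : ℝ, τ < T₁ → ∀ x : EuclideanSpace ℝ (Fin 3), u (τ + P) x = -u τ x) →
          uncurry u =ᵐ[volume.restrict (Iio (0 : ℝ) ×ˢ (univ : Set (EuclideanSpace ℝ (Fin 3))))] 0 := by
  intro ρ hρ u p H c hcl h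
  obtain ⟨T₁, P, hT₁, hTP, hanti⟩ := h
  -- the partner: the time translate, a distributional Euler pair on `(−∞, min 0 (−P)) × ℝ³`
  have h1 := hcl.1.distributional.stRescale (α := 1) (γ := 1) (β := 1) one_pos one_pos (by norm_num) P 0
  have hQ : stPreimage 1 1 P (0 : EuclideanSpace ℝ (Fin 3)) (slab (EuclideanSpace ℝ (Fin 3)) (Iio 0) isOpen_Iio) =
      slab (EuclideanSpace ℝ (Fin 3)) (Iio (-P)) isOpen_Iio := by
    apply TopologicalSpace.Opens.ext
    ext z
    simp only [coe_stPreimage, coe_slab, mem_preimage, mem_prod, mem_univ, and_true, mem_Iio, stAffine_fst, one_mul]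
    constructor <;> intro h <;> linarith
  rw [hQ, mul_zero, zero_div] at h1
  have h0 : ((1 : ℝ) ^ 2 * 1) • stPull 1 1 P (0 : EuclideanSpace ℝ (Fin 3)) (0 : ℝ → EuclideanSpace ℝ (Fin 3) → EuclideanSpace ℝ (Fin 3)) = 0 := by
    funext s y
    simp
  rw [h0, one_pow, one_smul, one_smul] at h1
  have h2 : IsDistributionalNSSolutionOn (slab (EuclideanSpace ℝ (Fin 3)) (Iio (min 0 (-P))) isOpen_Iio) 0 0
      (stPull 1 1 P (0 : EuclideanSpace ℝ (Fin 3)) u) (stPull 1 1 P (0 : EuclideanSpace ℝ (Fin 3)) p) :=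
    h1.of_le (slab_mono (Iio_subset_Iio (min_le_right _ _)))
  refine Loc.ae_eq_zero_of_negPair hρ hcl.1 hcl.2.1 hcl.2.2 (min_le_left _ _) (le_min hT₁ (by linarith)) h2 fun τ hτ x => ?_
  rw [stPull_apply, one_mul, one_smul, zero_add, add_comm P τ]
  exact hanti τ hτ x

/-! ## 3. Affine wrong parity (symmetry centre anywhere) and sign-alternating discrete self-similarity (hand g3, append) -/

/-- **AFFINE WRONG PARITY: the symmetry centre need not be the blow-up point.**  A class member with `u(τ, Ry + d) = −R u(τ, y)` for all `τ < T₁ ≤ 0`,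
all `y`, some linear isometry `R` and some `d ∈ ℝ³` (an AFFINE isometry of `ℝ³`; the gauges are anchored at the origin, but the partner
`R u(τ, R⁻¹(x − d))` — conjugate, then translate — only has to be a distributional Euler pair) is trivial. [folklore; MajdaBertozziCUP2002 §1.2 Prop. 1.1] -/
theorem Birth.nonSelfSimilar_of_affineAntiEquivariantMember :
    ∀ ρ : ℝ, 0 < ρ →
      ∀ (u : ℝ → EuclideanSpace ℝ (Fin 3) → EuclideanSpace ℝ (Fin 3)) (p : ℝ → EuclideanSpace ℝ (Fin 3) → ℝ)
        (H : ℝ → EuclideanSpace ℝ (Fin 3) → EuclideanSpace ℝ (Fin 3) →L[ℝ] EuclideanSpace ℝ (Fin 3)) (c : ℝ≥0),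
        Birth.InClass ρ u p H c →
          (∃ T₁ : ℝ, T₁ ≤ 0 ∧ ∃ (R : EuclideanSpace ℝ (Fin 3) ≃ₗᵢ[ℝ] EuclideanSpace ℝ (Fin 3)) (d : EuclideanSpace ℝ (Fin 3)),
              ∀ τ : ℝ, τ < T₁ → ∀ y : EuclideanSpace ℝ (Fin 3), u τ (R y + d) = -(R (u τ y))) →
          uncurry u =ᵐ[volume.restrict (Iio (0 : ℝ) ×ˢ (univ : Set (EuclideanSpace ℝ (Fin 3))))] 0 := by
  intro ρ hρ u p H c hcl h
  obtain ⟨T₁, hT₁, R, d, hanti⟩ := h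
  -- partner: conjugate by `R`, then translate (`x₀ = −d`)
  have hconj := PressureSlaving.isDistributional_conj_isometry isOpen_Iio hcl.1.distributional R
  have hf0 : (fun (s : ℝ) (x : EuclideanSpace ℝ (Fin 3)) =>
      R ((0 : ℝ → EuclideanSpace ℝ (Fin 3) → EuclideanSpace ℝ (Fin 3)) s (R.symm x))) = 0 := by
    funext s x
    simp
  rw [hf0] at hconj
  have h1 := hconj.stRescale (α := 1) (γ := 1) (β := 1) one_pos one_pos (by norm_num) 0 (-d)
  have hQ : stPreimage 1 1 0 (-d) (slab (EuclideanSpace ℝ (Fin 3)) (Iio 0) isOpen_Iio) =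
      slab (EuclideanSpace ℝ (Fin 3)) (Iio 0) isOpen_Iio := by
    apply TopologicalSpace.Opens.ext
    ext z
    simp only [coe_stPreimage, coe_slab, mem_preimage, mem_prod, mem_univ, and_true, mem_Iio, stAffine_fst, one_mul, zero_add]
  rw [hQ, mul_zero, zero_div] at h1
  have h0 : ((1 : ℝ) ^ 2 * 1) • stPull 1 1 0 (-d) (0 : ℝ → EuclideanSpace ℝ (Fin 3) → EuclideanSpace ℝ (Fin 3)) = 0 := by
    funext s y
    simp
  rw [h0, one_pow, one_smul, one_smul] at h1
  refine Loc.ae_eq_zero_of_negPair hρ hcl.1 hcl.2.1 hcl.2.2 le_rfl hT₁ h1 fun τ hτ x => ?_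
  have h2 := hanti τ hτ (R.symm (-d + x))
  rw [LinearIsometryEquiv.apply_symm_apply, neg_add_cancel_comm] at h2
  rw [stPull_apply, one_mul, one_smul, zero_add, h2, neg_neg]

/-- **EVEN ABOUT ANY CENTRE**: a class member with `u(τ, x₀ − y) = u(τ, x₀ + y)` for all `τ < T₁ ≤ 0`, all `y`, some centre `x₀` (not necessarily the
blow-up point), is trivial (`R = −1`, `d = 2x₀`). [folklore] -/
theorem Birth.nonSelfSimilar_of_evenMember_about :
    ∀ ρ : ℝ, 0 < ρ →
      ∀ (u : ℝ → EuclideanSpace ℝ (Fin 3) → EuclideanSpace ℝ (Fin 3)) (p : ℝ → EuclideanSpace ℝ (Fin 3) → ℝ)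
        (H : ℝ → EuclideanSpace ℝ (Fin 3) → EuclideanSpace ℝ (Fin 3) →L[ℝ] EuclideanSpace ℝ (Fin 3)) (c : ℝ≥0),
        Birth.InClass ρ u p H c →
          (∃ T₁ : ℝ, T₁ ≤ 0 ∧ ∃ x₀ : EuclideanSpace ℝ (Fin 3),
              ∀ τ : ℝ, τ < T₁ → ∀ y : EuclideanSpace ℝ (Fin 3), u τ (x₀ - y) = u τ (x₀ + y)) →
          uncurry u =ᵐ[volume.restrict (Iio (0 : ℝ) ×ˢ (univ : Set (EuclideanSpace ℝ (Fin 3))))] 0 := by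
  intro ρ hρ u p H c hcl h
  obtain ⟨T₁, hT₁, x₀, heven⟩ := h
  refine Birth.nonSelfSimilar_of_affineAntiEquivariantMember ρ hρ u p H c hcl
    ⟨T₁, hT₁, LinearIsometryEquiv.neg ℝ, x₀ + x₀, fun τ hτ y => ?_⟩
  have h1 := heven τ hτ (y - x₀)
  simp only [LinearIsometryEquiv.coe_neg, neg_neg]
  rw [show -y + (x₀ + x₀) = x₀ - (y - x₀) by abel, h1, show x₀ + (y - x₀) = y by abel]

/-- **SIGN-ALTERNATING DISCRETE SELF-SIMILARITY IS IMPOSSIBLE**: a class member with `α u(αγ τ, γ x) = −u(τ, x)` for all `τ < T₁ ≤ 0`, all `x`,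
some `α, γ > 0` (the two-parameter scaling group of Euler, with a SIGN FLIP) is trivial — although it IS discretely self-similar for the squared
scaling `(α², γ²)`, a member of the open DSS strata: the partner `α u(αγ ·, γ ·)` is a distributional Euler pair on the whole slab
(`IsDistributionalNSSolutionOn.stRescale`). [folklore; MajdaBertozziCUP2002 §1.2 Prop. 1.1 (iv)] -/
theorem Birth.nonSelfSimilar_of_signAlternatingDSS :
    ∀ ρ : ℝ, 0 < ρ →
      ∀ (u : ℝ → EuclideanSpace ℝ (Fin 3) → EuclideanSpace ℝ (Fin 3)) (p : ℝ → EuclideanSpace ℝ (Fin 3) → ℝ)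
        (H : ℝ → EuclideanSpace ℝ (Fin 3) → EuclideanSpace ℝ (Fin 3) →L[ℝ] EuclideanSpace ℝ (Fin 3)) (c : ℝ≥0),
        Birth.InClass ρ u p H c →
          (∃ T₁ : ℝ, T₁ ≤ 0 ∧ ∃ α γ : ℝ, 0 < α ∧ 0 < γ ∧
              ∀ τ : ℝ, τ < T₁ → ∀ x : EuclideanSpace ℝ (Fin 3), α • u (α * γ * τ) (γ • x) = -u τ x) →
          uncurry u =ᵐ[volume.restrict (Iio (0 : ℝ) ×ˢ (univ : Set (EuclideanSpace ℝ (Fin 3))))] 0 := by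
  intro ρ hρ u p H c hcl h
  obtain ⟨T₁, hT₁, α, γ, hα, hγ, hanti⟩ := h
  have h1 := hcl.1.distributional.stRescale (α := α) (γ := γ) (β := α * γ) hα hγ rfl 0 0
  have hQ : stPreimage (α * γ) γ 0 (0 : EuclideanSpace ℝ (Fin 3)) (slab (EuclideanSpace ℝ (Fin 3)) (Iio 0) isOpen_Iio) =
      slab (EuclideanSpace ℝ (Fin 3)) (Iio 0) isOpen_Iio := by
    apply TopologicalSpace.Opens.ext
    ext z
    simp only [coe_stPreimage, coe_slab, mem_preimage, mem_prod, mem_univ, and_true, mem_Iio, stAffine_fst, zero_add]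
    constructor
    · intro h
      by_contra h'
      have : 0 ≤ α * γ * z.1 := mul_nonneg (mul_pos hα hγ).le (not_lt.1 h')
      linarith
    · intro h
      have : 0 < α * γ * (-z.1) := mul_pos (mul_pos hα hγ) (by linarith)
      linarith
  rw [hQ, mul_zero, zero_div] at h1
  have h0 : (α ^ 2 * γ) • stPull (α * γ) γ 0 (0 : EuclideanSpace ℝ (Fin 3)) (0 : ℝ → EuclideanSpace ℝ (Fin 3) → EuclideanSpace ℝ (Fin 3)) = 0 := by
    funext s y
    simp
  rw [h0] at h1
  refine Loc.ae_eq_zero_of_negPair hρ hcl.1 hcl.2.1 hcl.2.2 le_rfl hT₁ h1 fun τ hτ x => ?_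
  show α • u (0 + α * γ * τ) ((0 : EuclideanSpace ℝ (Fin 3)) + γ • x) = -u τ x
  rw [zero_add, zero_add]
  exact hanti τ hτ x

end Summit.NavierStokesRegularity.NavierStokesRegularity.Theorems.PowerGaugeEulerLiouville

end
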